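import Literature.NumberTheory.Transcendental.DiazEstimates
import Literature.NumberTheory.Transcendental.DiazParams
import HarnessLib

/-!
# Diaz 1989, Théorème 1 — §II-4-2: the estimates for the chosen parameters (sizes and smallness)

Topic `Literature/NumberTheory/Transcendental` (trunk T-TRANSCEND). Decomposition step for the
named fact `Literature.NumberTheory.Transcendental.Diaz1989_thm1` (`DiazMain.lean`): with the parameters of
`DiazParams.lean` (§II-4-1 of G. Diaz, J. Number Theory 31 (1989), p. 15) we bound, for all large
`X`, every size entering the criterion by a multiple of `Φ₀ = X^{m+n}(log X)^{1/(n+1)}` and prove the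
smallness `|Q_{μj}(θ)| ≤ exp(-S)`, `S = c_S X^{m(n+1)} log X`, from the closed-form estimate
`norm_aeval_Qj_le` of `DiazEstimates.lean` (this is (7) and §II-4-2 (c) of the source, p. 15:
`|Q_{μj}(θ)| ≤ exp(-c₁₉ X^{m(n+1)} log X)`, together with (8), (9):
`deg Q_{μj}, h(Q_{μj}) ≤ c X^{m+n}(log X)^{1/(n+1)}`). Everything here is proved.

## References

* G. Diaz, *Grands degrés de transcendance pour des familles d'exponentielles*, J. Number Theory
  31 (1989), 1–23, §II-3-3 (8), (9) p. 11; §II-4-1, §II-4-2, p. 15.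
-/

noncomputable section

open Filter Real Finset Literature.NumberTheory.Transcendental.Asymp Literature.NumberTheory.Transcendental.Chudnovsky

namespace Literature.NumberTheory.Transcendental

namespace DiazThm1

variable {m n : ℕ}

/-- `Φ₀ = X^{m+n}(log X)^{1/(n+1)}`, the order of the degrees and heights.
[cite: Diaz1989, §II-4-2 p. 15 (deg, h ≤ c X^{m+n}(log X)^{1/(n+1)})] -/
def Phi0 (m n : ℕ) (X : ℝ) : ℝ := scale (m + n) (1 / (n + 1 : ℝ)) X

/-- `Ψ₀ = X^{m(n+1)} log X`, the order of `ρ` and of the smallness exponent.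
[cite: Diaz1989, §II-4-2 p. 15 (|Q_{μj}(θ)| ≤ exp(-c₁₉X^{m(n+1)} log X))] -/
def Psi0 (m n : ℕ) (X : ℝ) : ℝ := scale (m * (n + 1)) 1 X

/-- `Φ₀ ≥ 0` for `X ≥ 1`. [folklore] -/
theorem Phi0_nonneg {X : ℝ} (hX : 1 ≤ X) : 0 ≤ Phi0 m n X := scale_nonneg hX

/-- `Ψ₀ ≥ 0` for `X ≥ 1`. [folklore] -/
theorem Psi0_nonneg {X : ℝ} (hX : 1 ≤ X) : 0 ≤ Psi0 m n X := scale_nonneg hX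

/-- `D · log X ≤ Φ₀` (`X > 1`): the reason for the factor `(log X)^{-n/(n+1)}` in `D`. [folklore] -/
theorem D_mul_log_le {X : ℝ} (hX : 1 < X) : (Dp m n X : ℝ) * Real.log X ≤ Phi0 m n X := by
  calc (Dp m n X : ℝ) * Real.log X ≤ scale (m + n) (-(n / (n + 1 : ℝ))) X * Real.log X :=
        mul_le_mul_of_nonneg_right (D_le hX.le) (Real.log_nonneg hX.le)
    _ = Phi0 m n X := by
        rw [← scale_zero_one, scale_mul_scale hX, Phi0]
        congr 1 <;> [ring; (field_simp; ring)]

/-- `L · M ≤ a₁ Φ₀` and `L · M₁ ≤ a₁a₂ Φ₀` (`X ≥ 1`). [folklore] -/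
theorem L_mul_M_le (hm : 1 ≤ m) {X : ℝ} (hX : 1 < X) :
    (Lp m n X : ℝ) * Mp n X ≤ a1 m n * Phi0 m n X ∧
      (Lp m n X : ℝ) * M1p m n X ≤ a1 m n * a2 m n * Phi0 m n X := by
  have hL := L_le (m := m) (n := n) hX.le
  have hM := M_le (n := n) hX.le
  have e : scale (m - 1 : ℕ) (1 / (n + 1 : ℝ)) X * scale (n + 1) 0 X = Phi0 m n X := by
    rw [scale_mul_scale hX, Phi0]
    congr 1
    · push_cast [Nat.cast_sub hm]; ring
    · ring
  have h1 : (Lp m n X : ℝ) * Mp n X ≤ a1 m n * Phi0 m n X := by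
    calc (Lp m n X : ℝ) * Mp n X ≤ (a1 m n * scale (m - 1 : ℕ) (1 / (n + 1 : ℝ)) X) * scale (n + 1) 0 X :=
          mul_le_mul hL hM (Nat.cast_nonneg _) (mul_nonneg (Nat.cast_nonneg _) (scale_nonneg hX.le))
      _ = a1 m n * Phi0 m n X := by rw [mul_assoc, e]
  refine ⟨h1, ?_⟩
  calc (Lp m n X : ℝ) * M1p m n X = a2 m n * ((Lp m n X : ℝ) * Mp n X) := by
        unfold M1p; push_cast; ring
    _ ≤ a2 m n * (a1 m n * Phi0 m n X) := mul_le_mul_of_nonneg_left h1 (Nat.cast_nonneg _)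
    _ = a1 m n * a2 m n * Phi0 m n X := by ring

/-- `D ≤ Φ₀` for `X ≥ e`. [folklore] -/
theorem D_le_Phi0 {X : ℝ} (hX : Real.exp 1 ≤ X) : (Dp m n X : ℝ) ≤ Phi0 m n X := by
  have hX1 : 1 ≤ X := le_trans (by have := Real.add_one_le_exp (1 : ℝ); linarith) hX
  exact (D_le hX1).trans (scale_le_scale le_rfl (by
    have : (0 : ℝ) ≤ n / (n + 1 : ℝ) := by positivity
    have : (0 : ℝ) ≤ 1 / (n + 1 : ℝ) := by positivity
    linarith) hX)

/-- **The degree bound `T₀ ≤ (m + nm a₁) Φ₀`** (`X ≥ e`, `m ≥ 1`) — Diaz's (2), (8).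
[cite: Diaz1989, §II-3-3 (8) p. 11] -/
theorem T0_le (hm : 1 ≤ m) {X : ℝ} (hX : Real.exp 1 ≤ X) :
    (T0 m n (Dp m n X) (Lp m n X) (Mp n X) : ℝ) ≤ (m + n * m * a1 m n) * Phi0 m n X := by
  have hX1 : 1 < X := lt_of_lt_of_le (by have := Real.add_one_le_exp (1 : ℝ); linarith) hX
  have hD := D_le_Phi0 (m := m) (n := n) hX
  have hLM := (L_mul_M_le (n := n) hm hX1).1
  have hΦ := Phi0_nonneg (m := m) (n := n) hX1.le
  unfold T0
  have h1 : ((m * (Dp m n X - 1) + n * m * (Lp m n X * Mp n X - 1) : ℕ) : ℝ) ≤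
      m * (Dp m n X : ℝ) + n * m * ((Lp m n X : ℝ) * Mp n X) := by
    have a : ((Dp m n X - 1 : ℕ) : ℝ) ≤ Dp m n X := by exact_mod_cast Nat.sub_le _ _
    have b : ((Lp m n X * Mp n X - 1 : ℕ) : ℝ) ≤ (Lp m n X : ℝ) * Mp n X := by
      exact_mod_cast Nat.sub_le _ _
    have hm0 : (0 : ℝ) ≤ m := Nat.cast_nonneg m
    have hn0 : (0 : ℝ) ≤ n := Nat.cast_nonneg n
    push_cast
    have h1 := mul_le_mul_of_nonneg_left a hm0
    have h2 := mul_le_mul_of_nonneg_left b (mul_nonneg hn0 hm0)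
    linarith
  calc _ ≤ m * (Dp m n X : ℝ) + n * m * ((Lp m n X : ℝ) * Mp n X) := h1
    _ ≤ m * Phi0 m n X + n * m * (a1 m n * Phi0 m n X) := by
        gcongr
    _ = (m + n * m * a1 m n) * Phi0 m n X := by ring

/-- **The degree bound `T₁(M₁) ≤ (1 + nm a₁a₂) Φ₀`** (`X ≥ e`, `m ≥ 1`).
[cite: Diaz1989, §II-3-3 (8) p. 11] -/
theorem T1_le (hm : 1 ≤ m) {X : ℝ} (hX : Real.exp 1 ≤ X) :
    (T1 m n (Dp m n X) (Lp m n X) (M1p m n X) : ℝ) ≤ (1 + n * m * (a1 m n * a2 m n)) * Phi0 m n X := by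
  have hX1 : 1 < X := lt_of_lt_of_le (by have := Real.add_one_le_exp (1 : ℝ); linarith) hX
  have hD := D_le_Phi0 (m := m) (n := n) hX
  have hLM := (L_mul_M_le (n := n) hm hX1).2
  have hΦ := Phi0_nonneg (m := m) (n := n) hX1.le
  unfold T1
  push_cast
  have hn0 : (0 : ℝ) ≤ n := Nat.cast_nonneg n
  have hm0 : (0 : ℝ) ≤ m := Nat.cast_nonneg m
  have h2 := mul_le_mul_of_nonneg_left hLM (mul_nonneg hn0 hm0)
  linarith

/-! ### Crude sizes: everything polynomial in `X` is `≤ exp(Φ₀)` -/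

/-- `scale K 0 X = exp(K log X)` for `X > 0`. [folklore] -/
theorem scale_zero_eq_exp (K : ℝ) {X : ℝ} (hX : 0 < X) : scale K 0 X = Real.exp (K * Real.log X) := by
  rw [scale, Real.rpow_zero, mul_one, Real.rpow_def_of_pos hX, mul_comm]

/-- `X^K ≤ exp(Φ₀)` eventually, for every fixed `K` (`m + n > 0`). [folklore] -/
theorem eventually_scale_zero_le_exp_Phi0 (hmn : 0 < m + n) (K : ℝ) :
    ∀ᶠ X in atTop, scale K 0 X ≤ Real.exp (Phi0 m n X) := by
  have h := eventually_mul_scale_le_of_lt (a := 0) (a' := (m + n : ℕ)) (by exact_mod_cast hmn) 1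
    (1 / (n + 1 : ℝ)) K
  filter_upwards [h, eventually_gt_atTop (1 : ℝ)] with X hX hX1
  rw [scale_zero_eq_exp K (by linarith)]
  refine Real.exp_le_exp.mpr ?_
  rw [scale_zero_one] at hX
  rw [Phi0]; push_cast at hX ⊢; exact hX

/-- Eventually `D ≤ X^{m+n}`, `L ≤ X^m`, `M ≤ X^{n+1}`, `M₁ ≤ X^{n+2}` (as scales). [folklore] -/
theorem eventually_crude (hm : 1 ≤ m) :
    ∀ᶠ X in atTop, (Dp m n X : ℝ) ≤ scale (m + n) 0 X ∧ (Lp m n X : ℝ) ≤ scale m 0 X ∧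
      (Mp n X : ℝ) ≤ scale (n + 1) 0 X ∧ (M1p m n X : ℝ) ≤ scale (n + 2) 0 X := by
  have hL := eventually_mul_scale_le_of_lt (a := ((m - 1 : ℕ) : ℝ)) (a' := m)
    (by rw [Nat.cast_sub hm]; simp) (1 / (n + 1 : ℝ)) 0 (a1 m n)
  have hM1 := eventually_mul_scale_le_of_lt (a := ((n + 1 : ℕ) : ℝ)) (a' := n + 2)
    (by push_cast; linarith) 0 0 (a2 m n)
  filter_upwards [hL, hM1, eventually_ge_atTop (Real.exp 1)] with X hXL hXM1 hXe
  have hX1 : 1 ≤ X := le_trans (by have := Real.add_one_le_exp (1 : ℝ); linarith) hXe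
  refine ⟨(D_le hX1).trans (scale_le_scale le_rfl (by
      have : (0 : ℝ) ≤ n / (n + 1 : ℝ) := by positivity
      linarith) hXe), (L_le hX1).trans hXL, M_le hX1, ?_⟩
  calc (M1p m n X : ℝ) = a2 m n * Mp n X := by unfold M1p; push_cast; ring
    _ ≤ a2 m n * scale (n + 1) 0 X := mul_le_mul_of_nonneg_left (M_le hX1) (Nat.cast_nonneg _)
    _ ≤ scale (n + 2) 0 X := by push_cast at hXM1; exact hXM1

/-- **Cardinalities are `≤ exp(Φ₀)` eventually**: `#DL`, `#ExpIdx`, `#Unk`, `M^m` (`m ≥ 1`).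
[folklore] -/
theorem eventually_cards_le (hm : 1 ≤ m) :
    ∀ᶠ X in atTop,
      (Fintype.card (DL n (Dp m n X) (Lp m n X)) : ℝ) ≤ Real.exp (Phi0 m n X) ∧
      (Fintype.card (ExpIdx m n (Dp m n X) (Lp m n X) (Mp n X)) : ℝ) ≤ Real.exp (Phi0 m n X) ∧
      (Fintype.card (Unk m n (Dp m n X) (Lp m n X) (Mp n X)) : ℝ) ≤ Real.exp (Phi0 m n X) ∧
      (Mp n X : ℝ) ^ m ≤ Real.exp (Phi0 m n X) := by
  have hmn : 0 < m + n := by omega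
  filter_upwards [eventually_crude (n := n) hm, eventually_gt_atTop (1 : ℝ),
    eventually_scale_zero_le_exp_Phi0 (m := m) (n := n) hmn ((m + n) + m * n),
    eventually_scale_zero_le_exp_Phi0 (m := m) (n := n) hmn ((m + n) * m + (m + (n + 1)) * (n * m)),
    eventually_scale_zero_le_exp_Phi0 (m := m) (n := n) hmn
      (((m + n) + m * n) + ((m + n) * m + (m + (n + 1)) * (n * m))),
    eventually_scale_zero_le_exp_Phi0 (m := m) (n := n) hmn ((n + 1) * m)]
    with X hcr hX1 h1 h2 h3 h4
  obtain ⟨hD, hL, hM, -⟩ := hcr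
  have hD0 : (0 : ℝ) ≤ Dp m n X := Nat.cast_nonneg _
  have hL0 : (0 : ℝ) ≤ Lp m n X := Nat.cast_nonneg _
  have hM0 : (0 : ℝ) ≤ Mp n X := Nat.cast_nonneg _
  -- `#DL = D Lⁿ`
  have cDL : (Fintype.card (DL n (Dp m n X) (Lp m n X)) : ℝ) ≤ scale ((m + n) + m * n) 0 X := by
    have : (Fintype.card (DL n (Dp m n X) (Lp m n X)) : ℝ) = Dp m n X * (Lp m n X : ℝ) ^ n := by
      simp [Fintype.card_prod, Fintype.card_fin, Fintype.card_pi]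
    rw [this]
    calc (Dp m n X : ℝ) * (Lp m n X : ℝ) ^ n ≤ scale (m + n) 0 X * scale m 0 X ^ n :=
          mul_le_mul hD (pow_le_pow_left₀ hL0 hL n) (by positivity) (scale_nonneg hX1.le)
      _ = scale ((m + n) + m * n) 0 X := by
          rw [scale_pow hX1.le, scale_mul_scale hX1]; simp
  -- `#ExpIdx = D^m (LM)^{nm}`
  have cE : (Fintype.card (ExpIdx m n (Dp m n X) (Lp m n X) (Mp n X)) : ℝ) ≤
      scale ((m + n) * m + (m + (n + 1)) * (n * m)) 0 X := by
    have : (Fintype.card (ExpIdx m n (Dp m n X) (Lp m n X) (Mp n X)) : ℝ) =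
        (Dp m n X : ℝ) ^ m * ((Lp m n X : ℝ) * Mp n X) ^ (n * m) := by
      simp [Fintype.card_prod, Fintype.card_fin, Fintype.card_pi]
    rw [this]
    calc (Dp m n X : ℝ) ^ m * ((Lp m n X : ℝ) * Mp n X) ^ (n * m)
        ≤ scale (m + n) 0 X ^ m * (scale m 0 X * scale (n + 1) 0 X) ^ (n * m) :=
          mul_le_mul (pow_le_pow_left₀ hD0 hD m)
            (pow_le_pow_left₀ (by positivity) (mul_le_mul hL hM hM0 (scale_nonneg hX1.le)) _)
            (by positivity) (pow_nonneg (scale_nonneg hX1.le) _)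
      _ = scale ((m + n) * m + (m + (n + 1)) * (n * m)) 0 X := by
          rw [scale_mul_scale hX1, scale_pow hX1.le, scale_pow hX1.le, scale_mul_scale hX1]; simp
  refine ⟨cDL.trans h1, cE.trans h2, ?_, ?_⟩
  · have : (Fintype.card (Unk m n (Dp m n X) (Lp m n X) (Mp n X)) : ℝ) =
        (Fintype.card (DL n (Dp m n X) (Lp m n X)) : ℝ) *
          Fintype.card (ExpIdx m n (Dp m n X) (Lp m n X) (Mp n X)) := by
      rw [Fintype.card_prod]; push_cast; rfl
    rw [this]
    calc _ ≤ scale ((m + n) + m * n) 0 X * scale ((m + n) * m + (m + (n + 1)) * (n * m)) 0 X :=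
          mul_le_mul cDL cE (Nat.cast_nonneg _) (scale_nonneg hX1.le)
      _ = scale (((m + n) + m * n) + ((m + n) * m + (m + (n + 1)) * (n * m))) 0 X := by
          rw [scale_mul_scale hX1]; simp
      _ ≤ _ := h3
  · calc (Mp n X : ℝ) ^ m ≤ scale (n + 1) 0 X ^ m := pow_le_pow_left₀ hM0 hM m
      _ = scale ((n + 1) * m) 0 X := by rw [scale_pow hX1.le]; simp
      _ ≤ _ := h4

/-! ### The height of Siegel's step and the bound `Pmax` -/

/-- The height bound `H = #Unk · (mM)^D` of Siegel's step (`exists_coeffs`) for the parameters at `X`.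
[cite: Diaz1989, §II-2 (1) p. 5] -/
def Hgt (m n : ℕ) (X : ℝ) : ℝ :=
  Fintype.card (Unk m n (Dp m n X) (Lp m n X) (Mp n X)) * ((m : ℝ) * Mp n X) ^ Dp m n X

/-- `log M ≤ (n+1) log X` (`X ≥ 1`, `M ≥ 1`). [folklore] -/
theorem log_M_le {X : ℝ} (hX : 1 ≤ X) (hM : 1 ≤ Mp n X) :
    Real.log (Mp n X) ≤ (n + 1) * Real.log X := by
  have hMpos : (0 : ℝ) < Mp n X := by exact_mod_cast (show 0 < Mp n X by omega)
  calc Real.log (Mp n X) ≤ Real.log (scale (n + 1) 0 X) := Real.log_le_log hMpos (M_le hX)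
    _ = (n + 1) * Real.log X := by
        rw [scale, Real.rpow_zero, mul_one, Real.log_rpow (by linarith)]

/-- **`1 ≤ H ≤ exp((n+3)Φ₀)` eventually** (Diaz's (1): `log H(P_{dλ}) ≤ c₁(D log M + log L)`; `m ≥ 1`).
[cite: Diaz1989, §II-2 (1) p. 5] -/
theorem eventually_Hgt_le (hm : 1 ≤ m) :
    ∀ᶠ X in atTop, 1 ≤ Hgt m n X ∧ Hgt m n X ≤ Real.exp ((n + 3) * Phi0 m n X) := by
  filter_upwards [eventually_cards_le (n := n) hm, eventually_M_ge (n := n),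
    eventually_D_ge (m := m) (n := n) (by omega), eventually_L_ge (m := m) (n := n),
    eventually_ge_atTop (m : ℝ), eventually_gt_atTop (1 : ℝ)] with X hcards hM hD hL hXm hX1
  obtain ⟨-, -, hU, -⟩ := hcards
  have hM2 : (2 : ℝ) ≤ Mp n X := by exact_mod_cast hM.2
  have hm1 : (1 : ℝ) ≤ m := by exact_mod_cast hm
  have hmM : (1 : ℝ) ≤ (m : ℝ) * Mp n X := by nlinarith
  have hcard1 : (1 : ℝ) ≤ Fintype.card (Unk m n (Dp m n X) (Lp m n X) (Mp n X)) := by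
    have : 0 < Fintype.card (Unk m n (Dp m n X) (Lp m n X) (Mp n X)) := by
      rw [card_Unk]
      have := hD.2; have := hM.2; have := hL.2
      positivity
    exact_mod_cast this
  have hpow1 : (1 : ℝ) ≤ ((m : ℝ) * Mp n X) ^ Dp m n X := one_le_pow₀ hmM
  refine ⟨by unfold Hgt; nlinarith, ?_⟩
  -- `(mM)^D = exp(D log(mM))`, `log(mM) ≤ (n+2) log X`
  have hlogmM : Real.log ((m : ℝ) * Mp n X) ≤ (n + 2) * Real.log X := by
    rw [Real.log_mul (by positivity) (by positivity)]
    have h1 : Real.log m ≤ Real.log X := Real.log_le_log (by positivity) hXm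
    have h2 := log_M_le (n := n) hX1.le (by have := hM.2; omega)
    linarith
  have hpow : ((m : ℝ) * Mp n X) ^ Dp m n X ≤ Real.exp ((n + 2) * Phi0 m n X) := by
    rw [← Real.exp_log (pow_pos (by positivity) _), Real.log_pow]
    refine Real.exp_le_exp.mpr ?_
    calc (Dp m n X : ℝ) * Real.log ((m : ℝ) * Mp n X) ≤ Dp m n X * ((n + 2) * Real.log X) :=
          mul_le_mul_of_nonneg_left hlogmM (Nat.cast_nonneg _)
      _ = (n + 2) * (Dp m n X * Real.log X) := by ring
      _ ≤ (n + 2) * Phi0 m n X := mul_le_mul_of_nonneg_left (D_mul_log_le hX1) (by positivity)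
  unfold Hgt
  calc _ ≤ Real.exp (Phi0 m n X) * Real.exp ((n + 2) * Phi0 m n X) :=
        mul_le_mul hU hpow (by positivity) (by positivity)
    _ = Real.exp ((n + 3) * Phi0 m n X) := by rw [← Real.exp_add]; ring_nf

/-- The constant `K_P(A) = (m + nm a₁)(log 2 + log A) + n + 4` in `Pmax ≤ exp(K_P Φ₀)`. [folklore] -/
def KP (m n : ℕ) (A : ℝ) : ℝ := (m + n * m * a1 m n) * (Real.log 2 + Real.log A) + n + 4

/-- **`Pmax ≤ exp(K_P(A) Φ₀)` eventually** for every `A ≥ 1` (Diaz's (3), (6)). [cite: Diaz1989, §II-3-2 (3) p. 8] -/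
theorem eventually_Pmax_le (hm : 1 ≤ m) {A : ℝ} (hA : 1 ≤ A) :
    ∀ᶠ X in atTop, Pmax m n (Dp m n X) (Lp m n X) (Mp n X) (Hgt m n X) A ≤
      Real.exp (KP m n A * Phi0 m n X) := by
  filter_upwards [eventually_cards_le (n := n) hm, eventually_Hgt_le (n := n) hm,
    eventually_ge_atTop (Real.exp 1)] with X hcards hH hXe
  obtain ⟨-, hE, -, -⟩ := hcards
  have hX1 : 1 < X := lt_of_lt_of_le (by have := Real.add_one_le_exp (1 : ℝ); linarith) hXe
  have hT0 := T0_le (n := n) hm hXe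
  have hΦ := Phi0_nonneg (m := m) (n := n) hX1.le
  have hl2 : 0 ≤ Real.log 2 + Real.log A := by
    have := Real.log_nonneg (show (1:ℝ) ≤ 2 by norm_num); have := Real.log_nonneg hA; linarith
  set T : ℝ := (T0 m n (Dp m n X) (Lp m n X) (Mp n X) : ℝ) with hT
  have h2T : (2 : ℝ) ^ T0 m n (Dp m n X) (Lp m n X) (Mp n X) = Real.exp (T * Real.log 2) := by
    rw [← Real.exp_log (pow_pos two_pos _), Real.log_pow, hT]
  have hAT : A ^ T0 m n (Dp m n X) (Lp m n X) (Mp n X) = Real.exp (T * Real.log A) := by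
    rw [← Real.exp_log (pow_pos (by linarith) _), Real.log_pow, hT]
  unfold Pmax
  rw [h2T, hAT]
  calc Real.exp (T * Real.log 2) *
        ((Fintype.card (ExpIdx m n (Dp m n X) (Lp m n X) (Mp n X)) : ℝ) * Hgt m n X) *
        Real.exp (T * Real.log A)
      ≤ Real.exp (T * Real.log 2) * (Real.exp (Phi0 m n X) * Real.exp ((n + 3) * Phi0 m n X)) *
        Real.exp (T * Real.log A) := by
        refine mul_le_mul_of_nonneg_right (mul_le_mul_of_nonneg_left
          (mul_le_mul hE hH.2 (by linarith [hH.1]) (by positivity)) (by positivity)) (by positivity)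
    _ = Real.exp (T * (Real.log 2 + Real.log A) + (n + 4) * Phi0 m n X) := by
        rw [← Real.exp_add, ← Real.exp_add, ← Real.exp_add]; ring_nf
    _ ≤ Real.exp (KP m n A * Phi0 m n X) := by
        refine Real.exp_le_exp.mpr ?_
        unfold KP
        have := mul_le_mul_of_nonneg_right hT0 hl2
        nlinarith

/-! ### The bounds `ε₁`, `T_A`, `B_R`, `Λ` for the chosen parameters -/

/-- `((mM)^D ≤ exp((n+2)Φ₀)` eventually (`m ≥ 1`). [folklore] -/
theorem eventually_pow_mM_le (hm : 1 ≤ m) :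
    ∀ᶠ X in atTop, (1 : ℝ) ≤ (m : ℝ) * Mp n X ∧
      ((m : ℝ) * Mp n X) ^ Dp m n X ≤ Real.exp ((n + 2) * Phi0 m n X) := by
  filter_upwards [eventually_M_ge (n := n), eventually_ge_atTop (m : ℝ), eventually_gt_atTop (1 : ℝ)]
    with X hM hXm hX1
  have hM2 : (2 : ℝ) ≤ Mp n X := by exact_mod_cast hM.2
  have hm1 : (1 : ℝ) ≤ m := by exact_mod_cast hm
  have hmM : (1 : ℝ) ≤ (m : ℝ) * Mp n X := by nlinarith
  refine ⟨hmM, ?_⟩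
  have hlogmM : Real.log ((m : ℝ) * Mp n X) ≤ (n + 2) * Real.log X := by
    rw [Real.log_mul (by positivity) (by positivity)]
    have h1 : Real.log m ≤ Real.log X := Real.log_le_log (by positivity) hXm
    have h2 := log_M_le (n := n) hX1.le (by have := hM.2; omega)
    linarith
  rw [← Real.exp_log (pow_pos (by positivity) _), Real.log_pow]
  refine Real.exp_le_exp.mpr ?_
  calc (Dp m n X : ℝ) * Real.log ((m : ℝ) * Mp n X) ≤ Dp m n X * ((n + 2) * Real.log X) :=
        mul_le_mul_of_nonneg_left hlogmM (Nat.cast_nonneg _)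
    _ = (n + 2) * (Dp m n X * Real.log X) := by ring
    _ ≤ (n + 2) * Phi0 m n X := mul_le_mul_of_nonneg_left (D_mul_log_le hX1) (by positivity)

/-- `T₁(M) ≤ (1 + nm a₁) Φ₀` (`X ≥ e`, `m ≥ 1`). [folklore] -/
theorem T1_M_le (hm : 1 ≤ m) {X : ℝ} (hX : Real.exp 1 ≤ X) :
    (T1 m n (Dp m n X) (Lp m n X) (Mp n X) : ℝ) ≤ (1 + n * m * a1 m n) * Phi0 m n X := by
  have hX1 : 1 < X := lt_of_lt_of_le (by have := Real.add_one_le_exp (1 : ℝ); linarith) hX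
  have hD := D_le_Phi0 (m := m) (n := n) hX
  have hLM := (L_mul_M_le (n := n) hm hX1).1
  unfold T1
  push_cast
  have hn0 : (0 : ℝ) ≤ n := Nat.cast_nonneg n
  have hm0 : (0 : ℝ) ≤ m := Nat.cast_nonneg m
  have h2 := mul_le_mul_of_nonneg_left hLM (mul_nonneg hn0 hm0)
  linarith

/-- `x ≤ exp x`. [folklore] -/
theorem le_exp_self (x : ℝ) : x ≤ Real.exp x := by
  have := Real.add_one_le_exp x; linarith

/-- The constant `K_ε(A) = K_P(A) + n + 3 + (1 + nm a₁)(1 + log A)`. [folklore] -/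
def Keps (m n : ℕ) (A : ℝ) : ℝ := KP m n A + n + 3 + (1 + n * m * a1 m n) * (1 + Real.log A)

/-- **`ε₁ ≤ exp(K_ε Φ₀ - ρ)` eventually** (Diaz's (5)). [cite: Diaz1989, §II-3-2 (b) (5) p. 9] -/
theorem eventually_eps1_le (hm : 1 ≤ m) {A : ℝ} (hA : 1 ≤ A) :
    ∀ᶠ X in atTop, eps1 m n (Dp m n X) (Lp m n X) (Mp n X) (Hgt m n X) A (Real.exp (-rho m n X)) ≤
      Real.exp (Keps m n A * Phi0 m n X - rho m n X) := by
  filter_upwards [eventually_cards_le (n := n) hm, eventually_Pmax_le (n := n) hm hA,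
    eventually_pow_mM_le (n := n) hm, eventually_ge_atTop (Real.exp 1),
    eventually_Hgt_le (n := n) hm] with X hcards hP hmM hXe hH
  obtain ⟨hDL, -, -, -⟩ := hcards
  have hX1 : 1 < X := lt_of_lt_of_le (by have := Real.add_one_le_exp (1 : ℝ); linarith) hXe
  have hΦ := Phi0_nonneg (m := m) (n := n) hX1.le
  have hT1 := T1_M_le (n := n) hm hXe
  have hlA : 0 ≤ Real.log A := Real.log_nonneg hA
  set T : ℝ := (T1 m n (Dp m n X) (Lp m n X) (Mp n X) : ℝ) with hT
  have hT0 : 0 ≤ T := Nat.cast_nonneg _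
  have hAT : A ^ T1 m n (Dp m n X) (Lp m n X) (Mp n X) = Real.exp (T * Real.log A) := by
    rw [← Real.exp_log (pow_pos (by linarith) _), Real.log_pow, hT]
  have hTexp : T ≤ Real.exp T := le_exp_self T
  unfold eps1
  rw [hAT]
  have hPmax0 : 0 ≤ Pmax m n (Dp m n X) (Lp m n X) (Mp n X) (Hgt m n X) A :=
    Pmax_nonneg (by linarith [hH.1]) (by linarith)
  calc _ ≤ Real.exp (Phi0 m n X) * Real.exp (KP m n A * Phi0 m n X) *
        (Real.exp ((n + 2) * Phi0 m n X) * Real.exp T * Real.exp (T * Real.log A) *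
          Real.exp (-rho m n X)) := by
        refine mul_le_mul (mul_le_mul hDL hP hPmax0 (by positivity)) ?_ (by positivity) (by positivity)
        refine mul_le_mul_of_nonneg_right ?_ (by positivity)
        exact mul_le_mul (mul_le_mul hmM.2 hTexp hT0 (by positivity)) le_rfl (by positivity)
          (by positivity)
    _ = Real.exp ((KP m n A + n + 3) * Phi0 m n X + T * (1 + Real.log A) - rho m n X) := by
        simp only [← Real.exp_add]; ring_nf
    _ ≤ Real.exp (Keps m n A * Phi0 m n X - rho m n X) := by
        refine Real.exp_le_exp.mpr ?_
        unfold Keps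
        have := mul_le_mul_of_nonneg_right hT1 (show 0 ≤ 1 + Real.log A by linarith)
        nlinarith

/-- The constant `K_A = 1 + K_P + (m + nm a₁) + (n + 3) + U V a₁ a₂` in `T_A ≤ exp(K_A Φ₀ - ρ)`.
[folklore] -/
def KA (m n : ℕ) (A U V : ℝ) : ℝ :=
  1 + KP m n A + (m + n * m * a1 m n) + (n + 3) + U * V * (a1 m n * a2 m n)

/-- **`T_A ≤ exp(K_A Φ₀ - ρ)` eventually** (Diaz's (4)). [cite: Diaz1989, §II-3-2 (a) (4) p. 8] -/
theorem eventually_TAb_le (hm : 1 ≤ m) {A U V : ℝ} (hA : 1 ≤ A) (hU : 0 ≤ U) (hV : 0 ≤ V) :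
    ∀ᶠ X in atTop, TAb m n (Dp m n X) (Lp m n X) (Mp n X) (Hgt m n X) A (Real.exp (-rho m n X))
        (M1p m n X) U V ≤ Real.exp (KA m n A U V * Phi0 m n X - rho m n X) := by
  filter_upwards [eventually_cards_le (n := n) hm, eventually_Pmax_le (n := n) hm hA,
    eventually_Hgt_le (n := n) hm, eventually_crude (n := n) hm, eventually_M_ge (n := n),
    eventually_ge_atTop (max (Real.exp 1) (V + 1)), eventually_gt_atTop (1 : ℝ)]
    with X hcards hP hH hcr hM hXmax hX1
  obtain ⟨hDL, -, -, -⟩ := hcards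
  obtain ⟨-, -, -, hM1⟩ := hcr
  have hXe : Real.exp 1 ≤ X := le_trans (le_max_left _ _) hXmax
  have hXV : V + 1 ≤ X := le_trans (le_max_right _ _) hXmax
  have hlog1 : 1 ≤ Real.log X := by rw [Real.le_log_iff_exp_le (by linarith)]; exact hXe
  have hΦ := Phi0_nonneg (m := m) (n := n) hX1.le
  have hT0 := T0_le (n := n) hm hXe
  have hLM := (L_mul_M_le (n := n) hm hX1).2
  have hPmax0 : 0 ≤ Pmax m n (Dp m n X) (Lp m n X) (Mp n X) (Hgt m n X) A :=
    Pmax_nonneg (by linarith [hH.1]) (by linarith)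
  have hM1ge1 : (1 : ℝ) ≤ M1p m n X := by
    have : 1 ≤ M1p m n X := by
      unfold M1p; exact le_trans one_le_a2 (Nat.le_mul_of_pos_right _ (by have := hM.2; omega))
    exact_mod_cast this
  set T : ℝ := (T0 m n (Dp m n X) (Lp m n X) (Mp n X) : ℝ) with hT
  -- `(1 + M₁V)^D ≤ exp((n+3)Φ₀)`
  have hbase : (1 : ℝ) ≤ 1 + M1p m n X * V := by nlinarith
  have hlogb : Real.log (1 + M1p m n X * V) ≤ (n + 3) * Real.log X := by
    have h1 : 1 + (M1p m n X : ℝ) * V ≤ scale (n + 2) 0 X * X := by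
      calc 1 + (M1p m n X : ℝ) * V ≤ M1p m n X * (V + 1) := by nlinarith
        _ ≤ scale (n + 2) 0 X * X := mul_le_mul hM1 hXV (by linarith) (scale_nonneg hX1.le)
    calc Real.log (1 + M1p m n X * V) ≤ Real.log (scale (n + 2) 0 X * X) :=
          Real.log_le_log (by linarith) h1
      _ = (n + 3) * Real.log X := by
          rw [Real.log_mul (scale_pos hX1).ne' (by linarith), scale, Real.rpow_zero, mul_one,
            Real.log_rpow (by linarith)]; ring
  have hpowD : (1 + (M1p m n X : ℝ) * V) ^ Dp m n X ≤ Real.exp ((n + 3) * Phi0 m n X) := by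
    rw [← Real.exp_log (pow_pos (by linarith) _), Real.log_pow]
    refine Real.exp_le_exp.mpr ?_
    calc (Dp m n X : ℝ) * Real.log (1 + M1p m n X * V) ≤ Dp m n X * ((n + 3) * Real.log X) :=
          mul_le_mul_of_nonneg_left hlogb (Nat.cast_nonneg _)
      _ = (n + 3) * (Dp m n X * Real.log X) := by ring
      _ ≤ (n + 3) * Phi0 m n X := mul_le_mul_of_nonneg_left (D_mul_log_le hX1) (by positivity)
  have hexpL : Real.exp ((Lp m n X : ℝ) * U * ((M1p m n X : ℝ) * V)) ≤
      Real.exp (U * V * (a1 m n * a2 m n) * Phi0 m n X) := by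
    refine Real.exp_le_exp.mpr ?_
    have := mul_le_mul_of_nonneg_left hLM (mul_nonneg hU hV)
    nlinarith
  have hTexp : T ≤ Real.exp T := le_exp_self T
  unfold TAb
  calc _ ≤ Real.exp (Phi0 m n X) * (Real.exp (KP m n A * Phi0 m n X) * Real.exp T *
          Real.exp (-rho m n X)) * (Real.exp ((n + 3) * Phi0 m n X) *
          Real.exp (U * V * (a1 m n * a2 m n) * Phi0 m n X)) := by
        refine mul_le_mul (mul_le_mul hDL ?_ (by positivity) (by positivity))
          (mul_le_mul hpowD hexpL (by positivity) (by positivity)) (by positivity) (by positivity)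
        exact mul_le_mul (mul_le_mul hP hTexp (by positivity) (by positivity)) le_rfl
          (by positivity) (by positivity)
    _ = Real.exp ((1 + KP m n A + (n + 3) + U * V * (a1 m n * a2 m n)) * Phi0 m n X + T -
          rho m n X) := by simp only [← Real.exp_add]; ring_nf
    _ ≤ Real.exp (KA m n A U V * Phi0 m n X - rho m n X) := by
        refine Real.exp_le_exp.mpr ?_
        unfold KA
        nlinarith

/-- The radius `R = 8 r X^{mn-n}` of the big circle (`r = M₁(V+1)`; the source: `R = 5a₂c₉X^{mn+1}`).
[cite: Diaz1989, §II-4-1 p. 15] -/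
def Rbig (m n : ℕ) (V X : ℝ) : ℝ := 8 * ((M1p m n X : ℝ) * (V + 1)) * X ^ (m * n - n)

/-- The constants `K_B = 1 + K_P + (mn + 7)` and `K_R = 8U(V+1)a₁a₂` in
`B_R ≤ exp(K_B Φ₀ + K_R X^{mn+m}(log X)^{1/(n+1)})`. [folklore] -/
def KB (m n : ℕ) (A : ℝ) : ℝ := 1 + KP m n A + (m * n + 7)

/-- See `KB`. [folklore] -/
def KR (m n : ℕ) (U V : ℝ) : ℝ := 8 * U * (V + 1) * (a1 m n * a2 m n)

/-- **`B_R ≤ exp(K_B Φ₀ + K_R X^{mn+m}(log X)^{1/(n+1)})` eventually** (Diaz: `|F̃|_R ≤ exp c₁₀(D log R + LR)`).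
[cite: Diaz1989, §II-3-2 (c) p. 10] -/
theorem eventually_Bgr_le (hm : 1 ≤ m) {A U V : ℝ} (hA : 1 ≤ A) (hU : 0 ≤ U) (hV : 0 ≤ V) :
    ∀ᶠ X in atTop, Bgr m n (Dp m n X) (Lp m n X) (Mp n X) (Hgt m n X) A U (Rbig m n V X) ≤
      Real.exp (KB m n A * Phi0 m n X + KR m n U V * scale (m * n + m) (1 / (n + 1 : ℝ)) X) := by
  filter_upwards [eventually_cards_le (n := n) hm, eventually_Pmax_le (n := n) hm hA,
    eventually_Hgt_le (n := n) hm, eventually_crude (n := n) hm, eventually_M_ge (n := n),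
    eventually_ge_atTop (max 8 (V + 1)), eventually_gt_atTop (1 : ℝ)]
    with X hcards hP hH hcr hM hXmax hX1
  obtain ⟨hDL, -, -, -⟩ := hcards
  obtain ⟨-, -, -, hM1⟩ := hcr
  have hX8 : 8 ≤ X := le_trans (le_max_left _ _) hXmax
  have hXV : V + 1 ≤ X := le_trans (le_max_right _ _) hXmax
  have hlog0 : 0 ≤ Real.log X := Real.log_nonneg hX1.le
  have hΦ := Phi0_nonneg (m := m) (n := n) hX1.le
  have hLM := (L_mul_M_le (n := n) hm hX1).2
  have hPmax0 : 0 ≤ Pmax m n (Dp m n X) (Lp m n X) (Mp n X) (Hgt m n X) A :=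
    Pmax_nonneg (by linarith [hH.1]) (by linarith)
  have hM1ge1 : (1 : ℝ) ≤ M1p m n X := by
    have : 1 ≤ M1p m n X := by
      unfold M1p; exact le_trans one_le_a2 (Nat.le_mul_of_pos_right _ (by have := hM.2; omega))
    exact_mod_cast this
  have hXk : (1 : ℝ) ≤ X ^ (m * n - n) := one_le_pow₀ hX1.le
  have hr1 : (1 : ℝ) ≤ (M1p m n X : ℝ) * (V + 1) := by nlinarith
  have hR1 : (1 : ℝ) ≤ Rbig m n V X := by unfold Rbig; nlinarith
  have hmax : max 1 (Rbig m n V X) = Rbig m n V X := max_eq_right hR1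
  -- `log R ≤ (mn + 7) log X`
  have hlogR : Real.log (Rbig m n V X) ≤ (m * n + 7) * Real.log X := by
    have h8 : Real.log 8 ≤ Real.log X := Real.log_le_log (by norm_num) hX8
    have hr : Real.log ((M1p m n X : ℝ) * (V + 1)) ≤ (n + 3) * Real.log X := by
      calc Real.log ((M1p m n X : ℝ) * (V + 1)) ≤ Real.log (scale (n + 2) 0 X * X) :=
            Real.log_le_log (by positivity) (mul_le_mul hM1 hXV (by linarith) (scale_nonneg hX1.le))
        _ = (n + 3) * Real.log X := by
            rw [Real.log_mul (scale_pos hX1).ne' (by linarith), scale, Real.rpow_zero, mul_one,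
              Real.log_rpow (by linarith)]; ring
    have hk : Real.log (X ^ (m * n - n)) = ((m * n - n : ℕ) : ℝ) * Real.log X := by
      rw [Real.log_pow]
    have hk' : ((m * n - n : ℕ) : ℝ) ≤ m * n := by
      have : m * n - n ≤ m * n := Nat.sub_le _ _
      exact_mod_cast this
    unfold Rbig
    rw [Real.log_mul (by positivity) (by positivity), Real.log_mul (by norm_num) (by positivity), hk]
    have hmn : n ≤ m * n := Nat.le_mul_of_pos_left n (by omega)
    have h1 : ((m * n - n : ℕ) : ℝ) * Real.log X = ((m * n : ℝ) - n) * Real.log X := by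
      rw [Nat.cast_sub hmn]; push_cast; ring
    rw [h1]
    nlinarith [h8, hr, hlog0]
  have hpowD : (max 1 (Rbig m n V X)) ^ Dp m n X ≤ Real.exp ((m * n + 7) * Phi0 m n X) := by
    rw [hmax, ← Real.exp_log (pow_pos (by linarith) _), Real.log_pow]
    refine Real.exp_le_exp.mpr ?_
    calc (Dp m n X : ℝ) * Real.log (Rbig m n V X) ≤ Dp m n X * ((m * n + 7) * Real.log X) :=
          mul_le_mul_of_nonneg_left hlogR (Nat.cast_nonneg _)
      _ = (m * n + 7) * (Dp m n X * Real.log X) := by ring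
      _ ≤ (m * n + 7) * Phi0 m n X := mul_le_mul_of_nonneg_left (D_mul_log_le hX1) (by positivity)
  -- `L U R ≤ K_R scale(mn+m, 1/(n+1))`
  have hscale : Phi0 m n X * X ^ (m * n - n) = scale (m * n + m) (1 / (n + 1 : ℝ)) X := by
    have : (X : ℝ) ^ (m * n - n) = scale ((m * n - n : ℕ) : ℝ) 0 X := by
      rw [scale, Real.rpow_zero, mul_one, Real.rpow_natCast]
    rw [this, Phi0, scale_mul_scale hX1]
    congr 1
    · have hmn : n ≤ m * n := Nat.le_mul_of_pos_left n (by omega)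
      push_cast [Nat.cast_sub hmn]; ring
    · ring
  have hLUR : (Lp m n X : ℝ) * U * Rbig m n V X ≤ KR m n U V * scale (m * n + m) (1 / (n + 1 : ℝ)) X := by
    unfold Rbig KR
    rw [← hscale]
    have := mul_le_mul_of_nonneg_left hLM (show 0 ≤ 8 * U * (V + 1) * X ^ (m * n - n) by positivity)
    nlinarith [this]
  unfold Bgr
  calc _ ≤ Real.exp (Phi0 m n X) * Real.exp (KP m n A * Phi0 m n X) *
        (Real.exp ((m * n + 7) * Phi0 m n X) *
          Real.exp (KR m n U V * scale (m * n + m) (1 / (n + 1 : ℝ)) X)) := by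
        refine mul_le_mul (mul_le_mul hDL hP hPmax0 (by positivity))
          (mul_le_mul hpowD (Real.exp_le_exp.mpr hLUR) (by positivity) (by positivity))
          (by positivity) (by positivity)
    _ = Real.exp (KB m n A * Phi0 m n X + KR m n U V * scale (m * n + m) (1 / (n + 1 : ℝ)) X) := by
        simp only [← Real.exp_add]; unfold KB; ring_nf

/-! ### `Λ`, the powers of `r`, and the geometric factor `(2r/(R-r))^{M^m}` -/

/-- **`Λ ≥ exp(-(n+2)Ψ₀)` eventually**: for `0 < ω ≤ 1` (`ω = min(1,|v_m|/2)`) and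
`δ(M) = exp(-M log M)`, `(δ ω^M)^{M^{m'}} ≥ exp(-(n+2) X^{(m'+1)(n+1)} log X)`. [folklore] -/
theorem eventually_Lam_ge {m' : ℕ} {ω : ℝ} (hω0 : 0 < ω) (hω1 : ω ≤ 1) :
    ∀ᶠ X in atTop, Real.exp (-((n + 2) * Psi0 (m' + 1) n X)) ≤
      (Real.exp (-((Mp n X : ℝ) * Real.log (Mp n X))) * ω ^ Mp n X) ^ (Mp n X ^ m') := by
  filter_upwards [eventually_M_ge (n := n), eventually_ge_atTop (ω⁻¹), eventually_gt_atTop (1 : ℝ)]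
    with X hM hXω hX1
  have hM1 : 1 ≤ Mp n X := by have := hM.2; omega
  have hMr : (1 : ℝ) ≤ Mp n X := by exact_mod_cast hM1
  have hlogM := log_M_le (n := n) hX1.le hM1
  have hlogω : -Real.log ω ≤ Real.log X := by
    rw [← Real.log_inv]
    exact Real.log_le_log (inv_pos.mpr hω0) hXω
  have hlog0 : 0 ≤ Real.log X := Real.log_nonneg hX1.le
  -- write the right-hand side as one exponential
  have hωM : ω ^ Mp n X = Real.exp ((Mp n X : ℝ) * Real.log ω) := by
    rw [← Real.exp_log (pow_pos hω0 _), Real.log_pow]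
  rw [hωM, ← Real.exp_add, ← Real.exp_nat_mul]
  refine Real.exp_le_exp.mpr ?_
  -- `-(n+2)Ψ₀ ≤ M^{m'} (-M log M + M log ω)`, i.e. `M^{m'+1}(log M - log ω) ≤ (n+2)Ψ₀`
  have hMm : ((Mp n X ^ m' : ℕ) : ℝ) * (Mp n X : ℝ) ≤ scale ((m' + 1) * (n + 1)) 0 X := by
    have hMle := M_le (n := n) hX1.le
    calc ((Mp n X ^ m' : ℕ) : ℝ) * (Mp n X : ℝ) = (Mp n X : ℝ) ^ (m' + 1) := by push_cast; ring
      _ ≤ scale (n + 1) 0 X ^ (m' + 1) := pow_le_pow_left₀ (Nat.cast_nonneg _) hMle _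
      _ = scale ((m' + 1) * (n + 1)) 0 X := by rw [scale_pow hX1.le]; push_cast; ring_nf
  have hΨ : scale ((m' + 1) * (n + 1)) 0 X * Real.log X = Psi0 (m' + 1) n X := by
    rw [Psi0, ← scale_zero_one, scale_mul_scale hX1]; push_cast; ring_nf
  have hpos : 0 ≤ Real.log (Mp n X) - Real.log ω := by
    have := Real.log_nonneg hMr; have := Real.log_nonpos hω0.le hω1; linarith
  have key : ((Mp n X ^ m' : ℕ) : ℝ) * (Mp n X : ℝ) * (Real.log (Mp n X) - Real.log ω) ≤
      (n + 2) * Psi0 (m' + 1) n X := by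
    calc ((Mp n X ^ m' : ℕ) : ℝ) * (Mp n X : ℝ) * (Real.log (Mp n X) - Real.log ω)
        ≤ scale ((m' + 1) * (n + 1)) 0 X * ((n + 2) * Real.log X) :=
          mul_le_mul hMm (by linarith) hpos (scale_nonneg hX1.le)
      _ = (n + 2) * Psi0 (m' + 1) n X := by rw [← hΨ]; ring
  nlinarith [key]

/-- **`(c·r)^{M^m - 1} ≤ exp((n+4)Ψ₀)` eventually** for `1 ≤ c ≤ 8`, `r = M₁(V+1)`. [folklore] -/
theorem eventually_rpow_le (hm : 1 ≤ m) {V c : ℝ} (hV : 0 ≤ V) (hc : 1 ≤ c) (hc8 : c ≤ 8) :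
    ∀ᶠ X in atTop, (c * ((M1p m n X : ℝ) * (V + 1))) ^ (Mp n X ^ m - 1) ≤
      Real.exp ((n + 4) * Psi0 m n X) := by
  filter_upwards [eventually_cards_le (n := n) hm, eventually_crude (n := n) hm,
    eventually_M_ge (n := n), eventually_ge_atTop (max 8 (V + 1)), eventually_gt_atTop (1 : ℝ)]
    with X hcards hcr hM hXmax hX1
  obtain ⟨-, -, -, hM1⟩ := hcr
  have hX8 : 8 ≤ X := le_trans (le_max_left _ _) hXmax
  have hXV : V + 1 ≤ X := le_trans (le_max_right _ _) hXmax
  have hlog0 : 0 ≤ Real.log X := Real.log_nonneg hX1.le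
  have hM1ge1 : (1 : ℝ) ≤ M1p m n X := by
    have : 1 ≤ M1p m n X := by
      unfold M1p; exact le_trans one_le_a2 (Nat.le_mul_of_pos_right _ (by have := hM.2; omega))
    exact_mod_cast this
  set b : ℝ := c * ((M1p m n X : ℝ) * (V + 1)) with hb
  have hr1 : (1 : ℝ) ≤ (M1p m n X : ℝ) * (V + 1) := by nlinarith
  have hb1 : 1 ≤ b := by rw [hb]; nlinarith
  have hlogb : Real.log b ≤ (n + 4) * Real.log X := by
    have hc' : Real.log c ≤ Real.log X := Real.log_le_log (by linarith) (by linarith)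
    have hr : Real.log ((M1p m n X : ℝ) * (V + 1)) ≤ (n + 3) * Real.log X := by
      calc Real.log ((M1p m n X : ℝ) * (V + 1)) ≤ Real.log (scale (n + 2) 0 X * X) :=
            Real.log_le_log (by positivity) (mul_le_mul hM1 hXV (by linarith) (scale_nonneg hX1.le))
        _ = (n + 3) * Real.log X := by
            rw [Real.log_mul (scale_pos hX1).ne' (by linarith), scale, Real.rpow_zero, mul_one,
              Real.log_rpow (by linarith)]; ring
    rw [hb, Real.log_mul (by linarith) (by positivity)]
    linarith
  have hMm : ((Mp n X ^ m : ℕ) : ℝ) ≤ scale (m * (n + 1)) 0 X := by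
    calc ((Mp n X ^ m : ℕ) : ℝ) = (Mp n X : ℝ) ^ m := by push_cast; ring
      _ ≤ scale (n + 1) 0 X ^ m := pow_le_pow_left₀ (Nat.cast_nonneg _) (M_le hX1.le) _
      _ = scale (m * (n + 1)) 0 X := by rw [scale_pow hX1.le]; ring_nf
  have hΨ : scale (m * (n + 1)) 0 X * Real.log X = Psi0 m n X := by
    rw [Psi0, ← scale_zero_one, scale_mul_scale hX1]; ring_nf
  calc b ^ (Mp n X ^ m - 1) ≤ b ^ (Mp n X ^ m) := pow_le_pow_right₀ hb1 (Nat.sub_le _ _)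
    _ = Real.exp ((Mp n X ^ m : ℕ) * Real.log b) := by
        rw [← Real.exp_log (pow_pos (by linarith) _), Real.log_pow]
    _ ≤ Real.exp ((n + 4) * Psi0 m n X) := by
        refine Real.exp_le_exp.mpr ?_
        calc ((Mp n X ^ m : ℕ) : ℝ) * Real.log b ≤ scale (m * (n + 1)) 0 X * ((n + 4) * Real.log X) :=
              mul_le_mul hMm hlogb (Real.log_nonneg hb1) (scale_nonneg hX1.le)
          _ = (n + 4) * Psi0 m n X := by rw [← hΨ]; ring

/-- Elementary facts on `r = M₁(V+1)` and `R = 8rX^{mn-n}` (`X ≥ 1`, `M₁ ≥ 1`): `0 < r < R`,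
`R - r ≥ 4rX^{mn-n}`, `0 ≤ 2r/(R-r) ≤ X^{-(mn-n)}`, and `(2r/(R-r))(R+r) ≤ 6r`. [folklore] -/
theorem r_R_facts {V X : ℝ} (hV : 0 ≤ V) (hX : 1 ≤ X) (hM1 : (1 : ℝ) ≤ M1p m n X) :
    let r := (M1p m n X : ℝ) * (V + 1)
    0 < r ∧ r < Rbig m n V X ∧ 0 ≤ 2 * r / (Rbig m n V X - r) ∧
      2 * r / (Rbig m n V X - r) ≤ (X ^ (m * n - n))⁻¹ ∧
      2 * r / (Rbig m n V X - r) * (Rbig m n V X + r) ≤ 6 * r := by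
  intro r
  have hr : 0 < r := by positivity
  have hXk : (1 : ℝ) ≤ X ^ (m * n - n) := one_le_pow₀ hX
  have hR : Rbig m n V X = 8 * r * X ^ (m * n - n) := rfl
  have hRr : 4 * r * X ^ (m * n - n) ≤ Rbig m n V X - r := by rw [hR]; nlinarith
  have hRr0 : 0 < Rbig m n V X - r := by nlinarith
  refine ⟨hr, by linarith, by positivity, ?_, ?_⟩
  · rw [div_le_iff₀ hRr0, ← div_eq_inv_mul]
    rw [le_div_iff₀ (by positivity)]
    nlinarith
  · -- `2r(R+r) ≤ 6r(R-r)` iff `R + r ≤ 3R - 3r` iff `4r ≤ 2R`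
    rw [div_mul_eq_mul_div, div_le_iff₀ hRr0]
    nlinarith

/-- **`(2r/(R-r))^{M^m} ≤ exp(-(mn-n)2^{-m} Ψ₀)` eventually** (`m ≥ 1`). [folklore] -/
theorem eventually_qpow_le {V : ℝ} (hV : 0 ≤ V) :
    ∀ᶠ X in atTop, (2 * ((M1p m n X : ℝ) * (V + 1)) / (Rbig m n V X - (M1p m n X : ℝ) * (V + 1))) ^
        (Mp n X ^ m) ≤ Real.exp (-(((m * n - n : ℕ) : ℝ) / 2 ^ m * Psi0 m n X)) := by
  filter_upwards [eventually_M_ge (n := n), eventually_gt_atTop (1 : ℝ)] with X hM hX1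
  have hM1ge1 : (1 : ℝ) ≤ M1p m n X := by
    have : 1 ≤ M1p m n X := by
      unfold M1p; exact le_trans one_le_a2 (Nat.le_mul_of_pos_right _ (by have := hM.2; omega))
    exact_mod_cast this
  obtain ⟨hr, -, hq0, hq, -⟩ := r_R_facts (m := m) (n := n) hV hX1.le hM1ge1
  set q : ℝ := 2 * ((M1p m n X : ℝ) * (V + 1)) / (Rbig m n V X - (M1p m n X : ℝ) * (V + 1)) with hqdef
  have hXpos : 0 < X := by linarith
  have hXk : 0 < X ^ (m * n - n) := pow_pos hXpos _
  calc q ^ (Mp n X ^ m) ≤ ((X ^ (m * n - n))⁻¹) ^ (Mp n X ^ m) := pow_le_pow_left₀ hq0 hq _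
    _ = Real.exp (-(((Mp n X ^ m : ℕ) : ℝ) * (((m * n - n : ℕ) : ℝ) * Real.log X))) := by
        rw [← Real.exp_log (pow_pos (inv_pos.mpr hXk) _), Real.log_pow, Real.log_inv, Real.log_pow]
        ring_nf
    _ ≤ Real.exp (-(((m * n - n : ℕ) : ℝ) / 2 ^ m * Psi0 m n X)) := by
        refine Real.exp_le_exp.mpr (neg_le_neg ?_)
        -- `M^m ≥ (X^{n+1}/2)^m = X^{m(n+1)}/2^m`
        have hMm : scale (m * (n + 1)) 0 X / 2 ^ m ≤ ((Mp n X ^ m : ℕ) : ℝ) := by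
          calc scale (m * (n + 1)) 0 X / 2 ^ m = (scale (n + 1) 0 X / 2) ^ m := by
                rw [div_pow, scale_pow hX1.le]; ring_nf
            _ ≤ (Mp n X : ℝ) ^ m := pow_le_pow_left₀ (by have := scale_nonneg (a := n + 1) (b := 0) hX1.le; positivity) hM.1 _
            _ = ((Mp n X ^ m : ℕ) : ℝ) := by push_cast; ring
        have hΨ : scale (m * (n + 1)) 0 X * Real.log X = Psi0 m n X := by
          rw [Psi0, ← scale_zero_one, scale_mul_scale hX1]; ring_nf
        have hk0 : (0 : ℝ) ≤ ((m * n - n : ℕ) : ℝ) * Real.log X := by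
          have := Real.log_nonneg hX1.le; positivity
        calc ((m * n - n : ℕ) : ℝ) / 2 ^ m * Psi0 m n X
            = (scale (m * (n + 1)) 0 X / 2 ^ m) * (((m * n - n : ℕ) : ℝ) * Real.log X) := by
              rw [← hΨ]; ring
          _ ≤ ((Mp n X ^ m : ℕ) : ℝ) * (((m * n - n : ℕ) : ℝ) * Real.log X) :=
              mul_le_mul_of_nonneg_right hMm hk0

/-- **The eventual domination used for every constraint**: for `m ≥ 2`, `n ≥ 1`, any constants
`K₁, K₂, K₃` and `c > 0`, `K₁Φ₀ + K₂X^{mn+m}(log X)^{1/(n+1)} + K₃ ≤ cΨ₀` for all large `X` (the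
`X`-power `m+n < m(n+1)`, and the `log`-power `1/(n+1) < 1`, decide). [folklore] -/
theorem eventually_dominated (hm : 2 ≤ m) (hn : 1 ≤ n) (K₁ K₂ K₃ : ℝ) {c : ℝ} (hc : 0 < c) :
    ∀ᶠ X in atTop, K₁ * Phi0 m n X + K₂ * scale (m * n + m) (1 / (n + 1 : ℝ)) X + K₃ ≤ c * Psi0 m n X := by
  have hlt1 : ((m + n : ℕ) : ℝ) < (m : ℝ) * (n + 1) := by
    have h1 : (2 : ℝ) ≤ m := by exact_mod_cast hm
    have h2 : (1 : ℝ) ≤ n := by exact_mod_cast hn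
    push_cast; nlinarith
  have hlt2 : (1 / (n + 1 : ℝ)) < 1 := by
    rw [div_lt_one (by positivity)]; have : (1:ℝ) ≤ n := by exact_mod_cast hn
    linarith
  have h1 := eventually_mul_scale_le_of_lt hlt1 (1 / (n + 1 : ℝ)) 1 (3 * K₁ / c)
  have h2 := eventually_mul_scale_le_of_lt_right ((m : ℝ) * n + m) hlt2 (3 * K₂ / c)
  have h3 := eventually_const_le_scale (a := (m : ℝ) * (n + 1)) (b := 1) (Or.inl (by positivity)) (3 * K₃ / c)
  filter_upwards [h1, h2, h3] with X hX1 hX2 hX3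
  have e1 : scale ((m + n : ℕ) : ℝ) (1 / (n + 1 : ℝ)) X = Phi0 m n X := by rw [Phi0]; push_cast; rfl
  have e2 : scale ((m : ℝ) * n + m) 1 X = Psi0 m n X := by rw [Psi0]; ring_nf
  have e3 : scale ((m : ℝ) * (n + 1)) 1 X = Psi0 m n X := rfl
  rw [e1, e3] at hX1
  rw [e2] at hX2
  rw [e3] at hX3
  -- `3Kᵢ/c · (…) ≤ Ψ₀` for each `i`; sum up
  have hc3 : c / 3 > 0 := by positivity
  have i1 : K₁ * Phi0 m n X ≤ c / 3 * Psi0 m n X := by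
    have := mul_le_mul_of_nonneg_left hX1 hc3.le
    calc K₁ * Phi0 m n X = c / 3 * (3 * K₁ / c * Phi0 m n X) := by field_simp
      _ ≤ c / 3 * Psi0 m n X := this
  have i2 : K₂ * scale (m * n + m) (1 / (n + 1 : ℝ)) X ≤ c / 3 * Psi0 m n X := by
    have := mul_le_mul_of_nonneg_left hX2 hc3.le
    calc K₂ * scale (m * n + m) (1 / (n + 1 : ℝ)) X
        = c / 3 * (3 * K₂ / c * scale ((m : ℝ) * n + m) (1 / (n + 1 : ℝ)) X) := by
          field_simp
      _ ≤ c / 3 * Psi0 m n X := this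
  have i3 : K₃ ≤ c / 3 * Psi0 m n X := by
    have := mul_le_mul_of_nonneg_left hX3 hc3.le
    calc K₃ = c / 3 * (3 * K₃ / c) := by field_simp
      _ ≤ c / 3 * Psi0 m n X := this
  linarith

/-! ### The smallness `|Q_{μj}(θ)| ≤ exp(-c_S X^{m(n+1)} log X)` -/

/-- `c_S = (mn - n)/2^{m+2}`, the constant of the smallness exponent `S = c_S X^{m(n+1)} log X`
(the source's `c₁₉`). [cite: Diaz1989, §II-4-2 p. 15 (c₁₉)] -/
def cS (m n : ℕ) : ℝ := ((m * n - n : ℕ) : ℝ) / 2 ^ (m + 2)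

/-- `0 ≤ c_S ≤ n`. [folklore] -/
theorem cS_nonneg_le : 0 ≤ cS m n ∧ cS m n ≤ n := by
  refine ⟨by unfold cS; positivity, ?_⟩
  unfold cS
  rw [div_le_iff₀ (by positivity)]
  have h1 : ((m * n - n : ℕ) : ℝ) ≤ m * n := by exact_mod_cast Nat.sub_le _ _
  have h2 : (m : ℝ) ≤ 2 ^ m := by exact_mod_cast (Nat.lt_two_pow_self).le
  have hn : (0 : ℝ) ≤ n := Nat.cast_nonneg n
  calc ((m * n - n : ℕ) : ℝ) ≤ m * n := h1
    _ ≤ 2 ^ m * n := by nlinarith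
    _ ≤ n * 2 ^ (m + 2) := by rw [pow_add]; nlinarith [pow_nonneg (show (0:ℝ) ≤ 2 by norm_num) m]

/-- `c_S > 0` for `m ≥ 2`, `n ≥ 1`. [folklore] -/
theorem cS_pos (hm : 2 ≤ m) (hn : 1 ≤ n) : 0 < cS m n := by
  unfold cS
  have : 1 ≤ m * n - n := by
    have : n < m * n := by nlinarith
    omega
  have : (1 : ℝ) ≤ ((m * n - n : ℕ) : ℝ) := by exact_mod_cast this
  positivity

/-- Separation is monotone in `δ`. [folklore] -/
theorem Separated.mono {v : Fin m → ℂ} {M : ℕ} {δ δ' : ℝ} (h : Separated v M δ') (hle : δ ≤ δ') :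
    Separated v M δ := fun ν hν hνM => hle.trans (h ν hν hνM)

/-- A family with measure (b) has a non-zero last coordinate. [folklore] -/
theorem norm_last_pos_of_measureB {m' : ℕ} {v : Fin (m' + 1) → ℂ} {η : ℝ}
    (h : Diaz1989.MeasureB v η) : 0 < ‖v (Fin.last m')‖ := by
  obtain ⟨X₀, hX₀, hb⟩ := h
  set ν : Fin (m' + 1) → ℤ := Pi.single (Fin.last m') 1 with hν
  have hbound : ∀ k : Fin (m' + 1), (|ν k| : ℝ) ≤ max X₀ 1 + 1 := by
    intro k
    rw [hν, Pi.single_apply]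
    have h1 : (1 : ℝ) ≤ max X₀ 1 + 1 := by linarith [le_max_right X₀ 1]
    split_ifs
    · simp [h1]
    · simp only [abs_zero, Int.cast_zero]; linarith
  have := hb ν (by
    intro h0; have := congrFun h0 (Fin.last m'); simp [hν] at this) (max X₀ 1 + 1)
    (by linarith [le_max_left X₀ 1]) hbound
  simp only [hν, Pi.single_apply, Int.cast_ite, Int.cast_one, Int.cast_zero, ite_mul, one_mul, zero_mul,
    Finset.sum_ite_eq', Finset.mem_univ, if_true] at this
  exact lt_of_lt_of_le (Real.exp_pos _) this

set_option maxHeartbeats 1000000 in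
/-- **The smallness, pointwise form**: at a fixed `X > 1`, the closed-form estimate
`norm_aeval_Qj_le` together with the bounds of this file for `T_A, ε₁, B_R, Λ, (2r)^{S-1},
(6r)^{S-1}, (2r/(R-r))^S, M^m` and the three dominations gives `|Q_{μj}(θ)| ≤ exp(-c_S Ψ₀)`.
[cite: Diaz1989, §II-3-2 (7) p. 11 and §II-4-2 (c) p. 15] -/
theorem small_of_bounds {m' : ℕ} (hm' : 1 ≤ m') (hn : 1 ≤ n) (u : Fin n → ℂ)
    (v : Fin (m' + 1) → ℂ) {X A : ℝ} (hX1 : 1 < X) (hA1 : 1 ≤ A)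
    (hθA : ∀ i, ‖theta u v i‖ + 1 ≤ A) (hM2 : 2 ≤ Mp n X) (hH1 : 1 ≤ Hgt (m' + 1) n X)
    {δ : ℝ} (hδ0 : 0 < δ) (hδ1 : δ ≤ 1) (hsep : Separated v (Mp n X) δ)
    (hTA : TAb (m' + 1) n (Dp (m' + 1) n X) (Lp (m' + 1) n X) (Mp n X) (Hgt (m' + 1) n X) A
        (Real.exp (-rho (m' + 1) n X)) (M1p (m' + 1) n X) (Usum u) (Vsum v) ≤
      Real.exp (KA (m' + 1) n A (Usum u) (Vsum v) * Phi0 (m' + 1) n X - rho (m' + 1) n X))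
    (hε1 : eps1 (m' + 1) n (Dp (m' + 1) n X) (Lp (m' + 1) n X) (Mp n X) (Hgt (m' + 1) n X) A
        (Real.exp (-rho (m' + 1) n X)) ≤ Real.exp (Keps (m' + 1) n A * Phi0 (m' + 1) n X - rho (m' + 1) n X))
    (hBgr : Bgr (m' + 1) n (Dp (m' + 1) n X) (Lp (m' + 1) n X) (Mp n X) (Hgt (m' + 1) n X) A (Usum u)
        (Rbig (m' + 1) n (Vsum v) X) ≤ Real.exp (KB (m' + 1) n A * Phi0 (m' + 1) n X +
          KR (m' + 1) n (Usum u) (Vsum v) * scale ((m' + 1 : ℕ) * n + (m' + 1 : ℕ)) (1 / (n + 1 : ℝ)) X))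
    (hΛ : Real.exp (-((n + 2) * Psi0 (m' + 1) n X)) ≤ LamLB m' (Mp n X) δ v)
    (hr2 : (2 * ((M1p (m' + 1) n X : ℝ) * (Vsum v + 1))) ^ (Mp n X ^ (m' + 1) - 1) ≤
      Real.exp ((n + 4) * Psi0 (m' + 1) n X))
    (hr6 : (6 * ((M1p (m' + 1) n X : ℝ) * (Vsum v + 1))) ^ (Mp n X ^ (m' + 1) - 1) ≤
      Real.exp ((n + 4) * Psi0 (m' + 1) n X))
    (hq : (2 * ((M1p (m' + 1) n X : ℝ) * (Vsum v + 1)) /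
        (Rbig (m' + 1) n (Vsum v) X - (M1p (m' + 1) n X : ℝ) * (Vsum v + 1))) ^ (Mp n X ^ (m' + 1)) ≤
      Real.exp (-((((m' + 1) * n - n : ℕ) : ℝ) / 2 ^ (m' + 1) * Psi0 (m' + 1) n X)))
    (hSexp : (Mp n X : ℝ) ^ (m' + 1) ≤ Real.exp (Phi0 (m' + 1) n X))
    (hdA : KA (m' + 1) n A (Usum u) (Vsum v) * Phi0 (m' + 1) n X + Real.log 4 ≤
      (16 * (n + 1) - cS (m' + 1) n) * Psi0 (m' + 1) n X)
    (hd1 : (1 + Keps (m' + 1) n A) * Phi0 (m' + 1) n X + Real.log 4 ≤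
      (16 * (n + 1) - (2 * n + 6) - cS (m' + 1) n) * Psi0 (m' + 1) n X)
    (hd2 : KB (m' + 1) n A * Phi0 (m' + 1) n X + KR (m' + 1) n (Usum u) (Vsum v) *
        scale ((m' + 1 : ℕ) * n + (m' + 1 : ℕ)) (1 / (n + 1 : ℝ)) X + Real.log 4 ≤
      3 * cS (m' + 1) n * Psi0 (m' + 1) n X)
    (p : Unk (m' + 1) n (Dp (m' + 1) n X) (Lp (m' + 1) n X) (Mp n X) → ℤ)
    (hp : ∀ w, |(p w : ℝ)| ≤ Hgt (m' + 1) n X)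
    (hvan : ∀ μ' : Fin (m' + 1) → ℕ, (∀ k, μ' k < Mp n X) → Q p μ' = 0)
    (θ' : Var (m' + 1) n → ℂ) (hθ' : ∀ i, ‖theta u v i - θ' i‖ ≤ Real.exp (-rho (m' + 1) n X))
    (j : Var (m' + 1) n →₀ ℕ) (hj : IsMinIdx p θ' j)
    (μ : Fin (m' + 1) → ℕ) (hμ : ∀ k, μ k < M1p (m' + 1) n X) :
    ‖MvPolynomial.aeval (theta u v) (Qj p μ j)‖ ≤ Real.exp (-(cS (m' + 1) n * Psi0 (m' + 1) n X)) := by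
  classical
  have hV : 0 ≤ Vsum v := Finset.sum_nonneg fun _ _ => norm_nonneg _
  have hM1le : Mp n X ≤ M1p (m' + 1) n X :=
    Nat.le_mul_of_pos_left _ (by have := one_le_a2 (m := m' + 1) (n := n); omega)
  have hM1r : (1 : ℝ) ≤ M1p (m' + 1) n X := by exact_mod_cast (show 1 ≤ M1p (m' + 1) n X by omega)
  have hρ0 : 0 ≤ rho (m' + 1) n X := by
    unfold rho
    have := scale_nonneg (a := ((m' + 1 : ℕ) : ℝ) * (n + 1)) (b := 1) hX1.le
    push_cast at this ⊢
    positivity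
  have hε0 : 0 ≤ Real.exp (-rho (m' + 1) n X) := (Real.exp_pos _).le
  have hεle1 : Real.exp (-rho (m' + 1) n X) ≤ 1 := by rw [Real.exp_le_one_iff]; linarith
  have hθ : ∀ i, ‖theta u v i‖ ≤ A := fun i => by linarith [hθA i]
  have hθ'A : ∀ i, ‖θ' i‖ ≤ A := fun i => by
    have := norm_sub_norm_le (θ' i) (theta u v i)
    rw [norm_sub_rev] at this
    linarith [hθ' i, hθA i]
  obtain ⟨hr0, hrR, hq0, hq1, hqRr⟩ :=
    r_R_facts (m := m' + 1) (n := n) (V := Vsum v) (X := X) hV hX1.le hM1r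
  -- the closed-form estimate
  have key := norm_aeval_Qj_le u v (p := p) (by linarith) hp hA1 hε0 hθ hθ'A hθ' hM2 hM1le hvan
    hsep hδ0 hδ1 (R := Rbig (m' + 1) n (Vsum v) X) hrR hj hμ
  refine key.trans ?_
  -- shorthands (plain `have`-equations, all definitional)
  have hrad : rad (M1p (m' + 1) n X) v = (M1p (m' + 1) n X : ℝ) * (Vsum v + 1) := rfl
  rw [hrad]
  have hk : ((m' + 1) * n - n : ℕ) = ((m' + 1) * n - n : ℕ) := rfl
  have hkc : (((m' + 1) * n - n : ℕ) : ℝ) / 2 ^ (m' + 1) - cS (m' + 1) n = 3 * cS (m' + 1) n := by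
    unfold cS; rw [pow_add]; ring
  have hΛpos : 0 < LamLB m' (Mp n X) δ v := lt_of_lt_of_le (Real.exp_pos _) hΛ
  have hinvΛ : (LamLB m' (Mp n X) δ v)⁻¹ ≤ Real.exp ((n + 2) * Psi0 (m' + 1) n X) := by
    rw [inv_le_comm₀ hΛpos (Real.exp_pos _), ← Real.exp_neg]; exact hΛ
  have hS : (((Mp n X ^ (m' + 1) : ℕ)) : ℝ) ≤ Real.exp (Phi0 (m' + 1) n X) := by push_cast; exact hSexp
  have hS1 : 1 ≤ Mp n X ^ (m' + 1) := Nat.one_le_pow _ _ (by omega)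
  have he10 : 0 ≤ eps1 (m' + 1) n (Dp (m' + 1) n X) (Lp (m' + 1) n X) (Mp n X) (Hgt (m' + 1) n X) A
      (Real.exp (-rho (m' + 1) n X)) := by
    unfold eps1
    exact mul_nonneg (mul_nonneg (Nat.cast_nonneg _) (Pmax_nonneg (by linarith) (by linarith)))
      (by positivity)
  have hB0 : 0 ≤ Bgr (m' + 1) n (Dp (m' + 1) n X) (Lp (m' + 1) n X) (Mp n X) (Hgt (m' + 1) n X) A
      (Usum u) (Rbig (m' + 1) n (Vsum v) X) := by
    unfold Bgr
    exact mul_nonneg (mul_nonneg (Nat.cast_nonneg _) (Pmax_nonneg (by linarith) (by linarith)))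
      (by positivity)
  have hq1' : 2 * ((M1p (m' + 1) n X : ℝ) * (Vsum v + 1)) /
      (Rbig (m' + 1) n (Vsum v) X - (M1p (m' + 1) n X : ℝ) * (Vsum v + 1)) ≤ 1 :=
    hq1.trans (inv_le_one_of_one_le₀ (one_le_pow₀ hX1.le))
  have hρ : rho (m' + 1) n X = 16 * (n + 1) * Psi0 (m' + 1) n X := by
    unfold rho Psi0; push_cast; ring_nf
  -- generic names for readability
  generalize hSdef : (Mp n X ^ (m' + 1) : ℕ) = S at *
  generalize hrdef : (M1p (m' + 1) n X : ℝ) * (Vsum v + 1) = r at *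
  generalize hRdef : Rbig (m' + 1) n (Vsum v) X = Rr at *
  generalize hΛdef : LamLB m' (Mp n X) δ v = Λ at *
  generalize he1 : eps1 (m' + 1) n (Dp (m' + 1) n X) (Lp (m' + 1) n X) (Mp n X) (Hgt (m' + 1) n X) A
      (Real.exp (-rho (m' + 1) n X)) = e1 at *
  generalize hBdef : Bgr (m' + 1) n (Dp (m' + 1) n X) (Lp (m' + 1) n X) (Mp n X) (Hgt (m' + 1) n X) A
      (Usum u) Rr = B at *
  generalize hTAdef : TAb (m' + 1) n (Dp (m' + 1) n X) (Lp (m' + 1) n X) (Mp n X) (Hgt (m' + 1) n X) A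
      (Real.exp (-rho (m' + 1) n X)) (M1p (m' + 1) n X) (Usum u) (Vsum v) = TA at *
  set q : ℝ := 2 * r / (Rr - r) with hqdef
  -- the common target `Tgt = exp(-c_S Ψ₀ - log 4)`, `4 Tgt = exp(-c_S Ψ₀)`
  set Ψ := Psi0 (m' + 1) n X with hΨdef
  set Φ := Phi0 (m' + 1) n X with hΦdef
  set Tgt : ℝ := Real.exp (-(cS (m' + 1) n * Ψ) - Real.log 4) with hTgt
  have hTgt4 : 4 * Tgt = Real.exp (-(cS (m' + 1) n * Ψ)) := by
    rw [hTgt, Real.exp_sub, Real.exp_log (by norm_num)]; ring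
  -- (i)
  have b1 : TA ≤ Tgt := by
    refine hTA.trans (Real.exp_le_exp.mpr ?_)
    rw [hρ]; linarith
  -- (ii)
  have b2 : (S : ℝ) * e1 * (2 * r) ^ (S - 1) / Λ ≤ Tgt := by
    rw [div_eq_mul_inv]
    calc (S : ℝ) * e1 * (2 * r) ^ (S - 1) * Λ⁻¹
        ≤ Real.exp Φ * Real.exp (Keps (m' + 1) n A * Φ - rho (m' + 1) n X) *
          Real.exp ((n + 4) * Ψ) * Real.exp ((n + 2) * Ψ) := by
          refine mul_le_mul (mul_le_mul (mul_le_mul hS hε1 he10 (by positivity)) hr2 (by positivity)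
            (by positivity)) hinvΛ (by positivity) (by positivity)
      _ ≤ Tgt := by
          simp only [← Real.exp_add, hTgt]
          refine Real.exp_le_exp.mpr ?_
          rw [hρ]; linarith
  -- (iii)
  have b3 : q ^ S * B ≤ Tgt := by
    calc q ^ S * B ≤ Real.exp (-((((m' + 1) * n - n : ℕ) : ℝ) / 2 ^ (m' + 1) * Ψ)) *
          Real.exp (KB (m' + 1) n A * Φ + KR (m' + 1) n (Usum u) (Vsum v) *
            scale ((m' + 1 : ℕ) * n + (m' + 1 : ℕ)) (1 / (n + 1 : ℝ)) X) :=
          mul_le_mul hq hBgr hB0 (by positivity)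
      _ ≤ Tgt := by
          simp only [← Real.exp_add, hTgt]
          refine Real.exp_le_exp.mpr ?_
          nlinarith [hd2, hkc]
  -- (iv)
  have b4 : q ^ S * ((S : ℝ) * e1 * (Rr + r) ^ (S - 1) / Λ) ≤ Tgt := by
    have hRr0 : 0 ≤ Rr + r := by linarith
    have hgeom0 : 0 ≤ q ^ S * (Rr + r) ^ (S - 1) := mul_nonneg (pow_nonneg hq0 _) (pow_nonneg hRr0 _)
    have hgeom : q ^ S * (Rr + r) ^ (S - 1) ≤ (6 * r) ^ (S - 1) := by
      calc q ^ S * (Rr + r) ^ (S - 1) = q * (q * (Rr + r)) ^ (S - 1) := by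
            rw [mul_pow, ← mul_assoc, ← pow_succ']
            congr 2; omega
        _ ≤ 1 * (6 * r) ^ (S - 1) :=
            mul_le_mul hq1' (pow_le_pow_left₀ (mul_nonneg hq0 hRr0) hqRr _) (by positivity) zero_le_one
        _ = (6 * r) ^ (S - 1) := one_mul _
    calc q ^ S * ((S : ℝ) * e1 * (Rr + r) ^ (S - 1) / Λ)
        = (S : ℝ) * e1 * (q ^ S * (Rr + r) ^ (S - 1)) * Λ⁻¹ := by rw [div_eq_mul_inv]; ring
      _ ≤ Real.exp Φ * Real.exp (Keps (m' + 1) n A * Φ - rho (m' + 1) n X) *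
          Real.exp ((n + 4) * Ψ) * Real.exp ((n + 2) * Ψ) := by
          refine mul_le_mul (mul_le_mul (mul_le_mul hS hε1 he10 (by positivity)) (hgeom.trans hr6)
            hgeom0 (by positivity)) hinvΛ (by positivity) (by positivity)
      _ ≤ Tgt := by
          simp only [← Real.exp_add, hTgt]
          refine Real.exp_le_exp.mpr ?_
          rw [hρ]; linarith
  -- sum up
  rw [← hTgt4]
  have hdist : q ^ S * (B + (S : ℝ) * e1 * (Rr + r) ^ (S - 1) / Λ) =
      q ^ S * B + q ^ S * ((S : ℝ) * e1 * (Rr + r) ^ (S - 1) / Λ) := by ring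
  rw [hdist]
  linarith [b1, b2, b3, b4]

/-- **The smallness for the chosen parameters** (Diaz 1989, (7) and §II-4-2 (c), p. 15:
`|Q_{μj}(θ)| ≤ exp(-c₁₉ X^{m(n+1)} log X)`). For `m = m'+1 ≥ 2`, `n ≥ 1`, `v` with measure (b) (any
exponent), and all large `X`: if the unknowns `p` of Siegel's step are bounded by `H`, the `Q_{μ'}`
vanish for `|μ'| < M`, `θ̃` lies in the ball `𝓑_ρ` and `j` is a minimal index at `θ̃`, then
`|Q_{μj}(θ)| ≤ exp(-c_S X^{m(n+1)} log X)` for every `|μ| < M₁`.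
[cite: Diaz1989, §II-3-2 (7) p. 11 and §II-4-2 (c) p. 15] -/
theorem eventually_small {m' : ℕ} (hm' : 1 ≤ m') (hn : 1 ≤ n) (u : Fin n → ℂ)
    (v : Fin (m' + 1) → ℂ) {η : ℝ} (hBv : Diaz1989.MeasureB v η) :
    ∀ᶠ X in atTop, ∀ (p : Unk (m' + 1) n (Dp (m' + 1) n X) (Lp (m' + 1) n X) (Mp n X) → ℤ),
      (∀ w, |(p w : ℝ)| ≤ Hgt (m' + 1) n X) →
      (∀ μ' : Fin (m' + 1) → ℕ, (∀ k, μ' k < Mp n X) → Q p μ' = 0) →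
      ∀ θ' : Var (m' + 1) n → ℂ, (∀ i, ‖theta u v i - θ' i‖ ≤ Real.exp (-rho (m' + 1) n X)) →
      ∀ j : Var (m' + 1) n →₀ ℕ, IsMinIdx p θ' j →
      ∀ μ : Fin (m' + 1) → ℕ, (∀ k, μ k < M1p (m' + 1) n X) →
        ‖MvPolynomial.aeval (theta u v) (Qj p μ j)‖ ≤ Real.exp (-(cS (m' + 1) n * Psi0 (m' + 1) n X)) := by
  classical
  have hm : 1 ≤ m' + 1 := by omega
  have hm2 : 2 ≤ m' + 1 := by omega
  -- data-dependent constants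
  set A : ℝ := 2 + ∑ i, ‖theta u v i‖ with hAdef
  have hsum : 0 ≤ ∑ i, ‖theta u v i‖ := Finset.sum_nonneg fun i _ => norm_nonneg (theta u v i)
  have hA1 : 1 ≤ A := by rw [hAdef]; linarith
  have hθA : ∀ i, ‖theta u v i‖ + 1 ≤ A := fun i => by
    rw [hAdef]
    have := Finset.single_le_sum (fun i (_ : i ∈ Finset.univ) => norm_nonneg (theta u v i))
      (Finset.mem_univ i)
    linarith
  have hU : 0 ≤ Usum u := Finset.sum_nonneg fun _ _ => norm_nonneg _
  have hV : 0 ≤ Vsum v := Finset.sum_nonneg fun _ _ => norm_nonneg _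
  set ω : ℝ := min 1 (‖v (Fin.last m')‖ / 2) with hωdef
  have hω0 : 0 < ω := lt_min one_pos (by have := norm_last_pos_of_measureB hBv; linarith)
  have hω1 : ω ≤ 1 := min_le_left _ _
  obtain ⟨Xb, hXb0, hsepb⟩ := separated_of_measureB hBv
  have hcS := cS_nonneg_le (m := m' + 1) (n := n)
  have hcSpos := cS_pos hm2 hn
  filter_upwards [eventually_TAb_le (n := n) hm hA1 hU hV, eventually_eps1_le (n := n) hm hA1,
    eventually_Bgr_le (n := n) hm hA1 hU hV, eventually_Lam_ge (n := n) (m' := m') hω0 hω1,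
    eventually_rpow_le (n := n) hm hV (c := 2) (by norm_num) (by norm_num),
    eventually_rpow_le (n := n) hm hV (c := 6) (by norm_num) (by norm_num),
    eventually_qpow_le (m := m' + 1) (n := n) hV, eventually_cards_le (n := n) hm,
    eventually_M_ge (n := n), eventually_Hgt_le (n := n) hm,
    eventually_const_le_scale (a := n + 1) (b := 0) (Or.inl (by positivity)) (2 * Xb + 2),
    eventually_dominated hm2 hn (KA (m' + 1) n A (Usum u) (Vsum v)) 0 (Real.log 4)
      (c := 16 * (n + 1) - cS (m' + 1) n) (by linarith [hcS.2]),
    eventually_dominated hm2 hn (1 + Keps (m' + 1) n A) 0 (Real.log 4)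
      (c := 16 * (n + 1) - (2 * n + 6) - cS (m' + 1) n) (by
        have : (0 : ℝ) ≤ n := Nat.cast_nonneg n; linarith [hcS.2]),
    eventually_dominated hm2 hn (KB (m' + 1) n A) (KR (m' + 1) n (Usum u) (Vsum v)) (Real.log 4)
      (c := 3 * cS (m' + 1) n) (by linarith),
    eventually_gt_atTop (1 : ℝ)]
    with X hTA hε1 hBgr hΛ hr2 hr6 hq hcards hM hH hXb hdA hd1 hd2 hX1
    p hp hvan θ' hθ' j hj μ hμ
  obtain ⟨-, -, -, hSexp⟩ := hcards
  -- separation at `M`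
  have hMXb : (Xb : ℝ) < Mp n X := by have := hM.1; linarith
  set δ : ℝ := Real.exp (-((Mp n X : ℝ) * Real.log (Mp n X))) with hδdef
  have hδ0 : 0 < δ := Real.exp_pos _
  have hδ1 : δ ≤ 1 := by
    rw [hδdef, Real.exp_le_one_iff, neg_nonpos]
    have : (1 : ℝ) ≤ Mp n X := by exact_mod_cast (show 1 ≤ Mp n X by have := hM.2; omega)
    exact mul_nonneg (by linarith) (Real.log_nonneg this)
  have hsep : Separated v (Mp n X) δ :=
    (hsepb (Mp n X) hMXb).mono (Real.exp_le_exp.mpr (neg_le_neg (min_le_left _ _)))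
  simp only [zero_mul, add_zero] at hdA hd1
  exact small_of_bounds hm' hn u v hX1 hA1 hθA hM.2 hH.1 hδ0 hδ1 hsep hTA hε1 (by
    have := hBgr; push_cast at this ⊢; exact this) hΛ hr2 hr6 hq hSexp hdA hd1 (by
    have := hd2; push_cast at this ⊢; exact this) p hp hvan θ' hθ' j hj μ hμ

/-! ### Degrees and lengths of the `Q_{μj}` (the functions `δ = σ` of the criterion) -/

/-- `c_δ = (m + nm a₁)(1 + log 2) + (1 + nm a₁a₂) + 2n + 8`: `deg Q_{μj}, log L(Q_{μj}) ≤ c_δ Φ₀`.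
[cite: Diaz1989, §II-4-2 (b) p. 15 (c₁₇, c₁₈)] -/
def cdelta (m n : ℕ) : ℝ :=
  (m + n * m * a1 m n) * (1 + Real.log 2) + (1 + n * m * (a1 m n * a2 m n)) + 2 * n + 8

/-- `c_δ ≥ 1`. [folklore] -/
theorem one_le_cdelta : 1 ≤ cdelta m n := by
  unfold cdelta
  have h2 : 0 ≤ Real.log 2 := Real.log_nonneg (by norm_num)
  have : (0 : ℝ) ≤ (m + n * m * a1 m n) * (1 + Real.log 2) := by positivity
  have : (0 : ℝ) ≤ n * m * (a1 m n * a2 m n) := by positivity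
  have : (0 : ℝ) ≤ n := Nat.cast_nonneg n
  linarith

/-- **Degrees and lengths for the chosen parameters** (Diaz 1989, §II-4-2 (b), p. 15:
`deg Q_{μj} ≤ c₁₇X^{m+n}(log X)^{1/(n+1)}`, `h(Q_{μj}) ≤ c₁₈X^{m+n}(log X)^{1/(n+1)}`): eventually, for
unknowns bounded by `H` and `|μ| < M₁`, `deg Q_{μj} ≤ c_δ Φ₀` and `log L(Q_{μj}) ≤ c_δ Φ₀`.
[cite: Diaz1989, §II-4-2 (b) p. 15] -/
theorem eventually_deg_len (hm : 1 ≤ m) :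
    ∀ᶠ X in atTop, ∀ (p : Unk m n (Dp m n X) (Lp m n X) (Mp n X) → ℤ),
      (∀ w, |(p w : ℝ)| ≤ Hgt m n X) → ∀ μ : Fin m → ℕ, (∀ k, μ k < M1p m n X) →
      ∀ j : Var m n →₀ ℕ,
        ((Qj p μ j).totalDegree : ℝ) ≤ cdelta m n * Phi0 m n X ∧
        Real.log (l1 (Qj p μ j)) ≤ cdelta m n * Phi0 m n X := by
  filter_upwards [eventually_cards_le (n := n) hm, eventually_Hgt_le (n := n) hm,
    eventually_M_ge (n := n), eventually_ge_atTop (max (Real.exp 1) (max (m : ℝ) (a2 m n))),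
    eventually_gt_atTop (1 : ℝ)] with X hcards hH hM hXmax hX1 p hp μ hμ j
  obtain ⟨hDL, hE, -, -⟩ := hcards
  have hXe : Real.exp 1 ≤ X := le_trans (le_max_left _ _) hXmax
  have hXm : (m : ℝ) ≤ X := le_trans (le_trans (le_max_left _ _) (le_max_right _ _)) hXmax
  have hXa2 : (a2 m n : ℝ) ≤ X := le_trans (le_trans (le_max_right _ _) (le_max_right _ _)) hXmax
  have hΦ := Phi0_nonneg (m := m) (n := n) hX1.le
  have hT0 := T0_le (n := n) hm hXe
  have hT1 := T1_le (n := n) hm hXe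
  have h2 : 0 ≤ Real.log 2 := Real.log_nonneg (by norm_num)
  have hn0 : (0 : ℝ) ≤ n := Nat.cast_nonneg n
  have hnm : (0 : ℝ) ≤ n * m * (a1 m n * a2 m n) := by positivity
  have hma : (0 : ℝ) ≤ m + n * m * a1 m n := by positivity
  constructor
  · have := totalDegree_Qj_le p hμ j (M' := M1p m n X)
    have h' : ((Qj p μ j).totalDegree : ℝ) ≤ T0 m n (Dp m n X) (Lp m n X) (Mp n X) +
        T1 m n (Dp m n X) (Lp m n X) (M1p m n X) := by exact_mod_cast this
    calc ((Qj p μ j).totalDegree : ℝ) ≤ (m + n * m * a1 m n) * Phi0 m n X +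
          (1 + n * m * (a1 m n * a2 m n)) * Phi0 m n X := by linarith
      _ ≤ cdelta m n * Phi0 m n X := by unfold cdelta; nlinarith
  · -- `L(Q) ≤ #DL 2^{T0} #E H (mM₁)^D ≤ exp(c_δ Φ₀)`
    have hl1 := l1_Qj_le (n := n) hm p hp hμ j
    have hM2 : (2 : ℝ) ≤ Mp n X := by exact_mod_cast hM.2
    have hm1 : (1 : ℝ) ≤ m := by exact_mod_cast hm
    have hM1r : (1 : ℝ) ≤ M1p m n X := by
      have : 1 ≤ M1p m n X := by
        unfold M1p; exact le_trans one_le_a2 (Nat.le_mul_of_pos_right _ (by have := hM.2; omega))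
      exact_mod_cast this
    have hmM1 : (1 : ℝ) ≤ (m : ℝ) * M1p m n X := by nlinarith
    -- `(mM₁)^D ≤ exp((n+3)Φ₀)`
    have hlogmM1 : Real.log ((m : ℝ) * M1p m n X) ≤ (n + 3) * Real.log X := by
      have hM1eq : (M1p m n X : ℝ) = a2 m n * Mp n X := by unfold M1p; push_cast; ring
      have ha2pos : (0 : ℝ) < a2 m n := by exact_mod_cast (one_le_a2 (m := m) (n := n))
      have hmpos : (0 : ℝ) < m := by linarith
      have hMpos : (0 : ℝ) < Mp n X := by linarith
      rw [hM1eq, Real.log_mul hmpos.ne' (mul_pos ha2pos hMpos).ne', Real.log_mul ha2pos.ne' hMpos.ne']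
      have h1 : Real.log m ≤ Real.log X := Real.log_le_log hmpos hXm
      have h2' : Real.log (a2 m n) ≤ Real.log X := Real.log_le_log ha2pos hXa2
      have h3 := log_M_le (n := n) hX1.le (by have := hM.2; omega)
      linarith
    have hpow : ((m : ℝ) * M1p m n X) ^ Dp m n X ≤ Real.exp ((n + 3) * Phi0 m n X) := by
      rw [← Real.exp_log (pow_pos (by positivity) _), Real.log_pow]
      refine Real.exp_le_exp.mpr ?_
      calc (Dp m n X : ℝ) * Real.log ((m : ℝ) * M1p m n X) ≤ Dp m n X * ((n + 3) * Real.log X) :=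
            mul_le_mul_of_nonneg_left hlogmM1 (Nat.cast_nonneg _)
        _ = (n + 3) * (Dp m n X * Real.log X) := by ring
        _ ≤ (n + 3) * Phi0 m n X := mul_le_mul_of_nonneg_left (D_mul_log_le hX1) (by positivity)
    set T : ℝ := (T0 m n (Dp m n X) (Lp m n X) (Mp n X) : ℝ) with hT
    have h2T : (2 : ℝ) ^ T0 m n (Dp m n X) (Lp m n X) (Mp n X) = Real.exp (T * Real.log 2) := by
      rw [← Real.exp_log (pow_pos two_pos _), Real.log_pow, hT]
    have hbound : l1 (Qj p μ j) ≤ Real.exp (cdelta m n * Phi0 m n X) := by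
      refine hl1.trans ?_
      rw [h2T]
      calc (Fintype.card (DL n (Dp m n X) (Lp m n X)) : ℝ) *
            (Real.exp (T * Real.log 2) * ((Fintype.card (ExpIdx m n (Dp m n X) (Lp m n X) (Mp n X)) : ℝ) *
              Hgt m n X) * ((m : ℝ) * M1p m n X) ^ Dp m n X)
          ≤ Real.exp (Phi0 m n X) * (Real.exp (T * Real.log 2) * (Real.exp (Phi0 m n X) *
              Real.exp ((n + 3) * Phi0 m n X)) * Real.exp ((n + 3) * Phi0 m n X)) := by
            have hH0 : 0 ≤ Hgt m n X := by linarith [hH.1]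
            refine mul_le_mul hDL (mul_le_mul (mul_le_mul_of_nonneg_left
              (mul_le_mul hE hH.2 hH0 (by positivity)) (by positivity)) hpow
              (by positivity) (by positivity)) (by positivity) (by positivity)
        _ = Real.exp (T * Real.log 2 + (2 * n + 8) * Phi0 m n X) := by
            simp only [← Real.exp_add]; ring_nf
        _ ≤ Real.exp (cdelta m n * Phi0 m n X) := by
            refine Real.exp_le_exp.mpr ?_
            unfold cdelta
            have := mul_le_mul_of_nonneg_right hT0 h2
            nlinarith
    by_cases h0 : l1 (Qj p μ j) = 0
    · rw [h0, Real.log_zero]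
      have := one_le_cdelta (m := m) (n := n)
      positivity
    · have hpos : 0 < l1 (Qj p μ j) := lt_of_le_of_ne (wnorm_nonneg _ _) (Ne.symm h0)
      exact (Real.log_le_iff_le_exp hpos).mpr hbound

end DiazThm1









end Literature.NumberTheory.Transcendental

end
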